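import Literature.AlgebraicGeometry.Resolution.PermissibleBlowupDirectrixNear
import HarnessLib

/-!
# `e` does not increase at a near point with TRIVIAL residue extension (consequence of CJS Thm. 3.10 (4))

Topic: `Literature/AlgebraicGeometry/Resolution`. PROVED consequence (no new premise) of the named fact
`CossartJannsenSaito2020_thm_3_10_4` (`PermissibleBlowupDirectrix.lean`; Cossart–Jannsen–Saito, LNM 2270 (2020),
Thm. 3.10 (4): at a near point `x'` of the blow-up in a permissible centre `D ∋ x`, for any field `K` over `k(x')`,
`e_{x'}(X')_K ≤ e_x(X)_K − δ_{x'/x}`): **if `k(x) → k(x')` is an isomorphism (`x'` is `k(x)`-rational, e.g. the unique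
near point on `ℙ(Dir_x(X)) ≅ ℙ⁰_{k(x)}` when `e_x(X) = 1`, CJS Def. 6.34 (i) / p. 103 L32 «if `e^O_x(X) ≤ 1` then
`k(y) = k(x)`»), then `e_{x'}(X') ≤ e_x(X)`** — take `K = k(x')`: `e_{x'}(X')_{k(x')} = e_{x'}(X')` (CJS Def. 2.18) and
`e_x(X)_{k(x')} = e_x(X)_{k(x)} = e_x(X)` along the isomorphism (tree `dirDimOver_eq_of_algEquiv`, `dirDimOver_residueField`).
This is the step «`e` stays `≤ 1` along the fundamental sequence of point blow-ups over a point with `e = 1`» used with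
Cor. 6.37 (the third door / grade-1 bridge of the Hilbert–Samuel route, stmt-ResolutionOfSingularities-19249). Without the
rationality hypothesis only `e_{x'}(X') ≤ e_x(X)_{k(x')}` holds (`dirDim_le_dirDimOver_of_hsFun_eq`), and `e_x(X)_{k(x')}` may
exceed `e_x(X)` (CJS Lemma 2.20 (2)).

* `dirDim_le_dirDimOver_of_hsFun_eq` — `e_{x'}(X') ≤ e_x(X)_{k(x')}` at every near point over the centre;
* `dirDim_le_of_hsFun_eq_of_isIso_residueFieldMap` — `e_{x'}(X') ≤ e_x(X)` when `k(x) ⥲ k(x')`.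

## Sources

* V. Cossart, U. Jannsen, S. Saito, LNM 2270 (2020), Thm. 3.10 (4), Def. 2.18, Lemma 2.20 (2), Def. 2.26, Def. 6.34 (i),
  p. 103. [CossartJannsenSaito2020]
-/

noncomputable section

open CategoryTheory AlgebraicGeometry TopologicalSpace IsLocalRing
open Literature.RingTheory.HilbertSamuel

namespace Literature.AlgebraicGeometry.Resolution

universe u

variable {X X' : Scheme.{u}} [IsLocallyNoetherian X] [IsLocallyNoetherian X'] {π : X' ⟶ X}
  {D : X.IdealSheafData}

/-- **`e_{x'}(X') ≤ e_x(X)_{k(x')}` at a near point over the centre** (the fact with `K = k(x')` and `δ` dropped;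
`e_{x'}(X')_{k(x')} = e_{x'}(X')`, CJS Def. 2.18). [cite: CossartJannsenSaito2020, Thm. 3.10 (4), Def. 2.18] -/
theorem dirDim_le_dirDimOver_of_hsFun_eq (h : CossartJannsenSaito2020_thm_3_10_4.{u})
    (hX : Scheme.IsExcellent X) (hD : IdealSheafData.IsPermissible D) (hπ : IsBlowup π D)
    {N : ℕ} (hN : topologicalKrullDim X ≤ (N : WithBot ℕ∞)) {x' : X'}
    (hx : π.base x' ∈ (D.support : Set X))
    (hnear : Scheme.hsFun X' N x' = Scheme.hsFun X N (π.base x')) :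
    Scheme.dirDim X' x' ≤
      @Scheme.dirDimOver X _ (π.base x') (ResidueField (X'.presheaf.stalk x')) _
        (π.residueFieldMap x').hom.toAlgebra := by
  letI : Algebra (ResidueField (X.presheaf.stalk (π.base x'))) (ResidueField (X'.presheaf.stalk x')) :=
    (π.residueFieldMap x').hom.toAlgebra
  have hle := dirDimOver_le_of_hsFun_eq h hX hD hπ hN hx hnear (ResidueField (X'.presheaf.stalk x')) fun _ => rfl
  rwa [Scheme.dirDimOver_residueField] at hle

/-- **`e_{x'}(X') ≤ e_x(X)` at a near point with trivial residue extension** (`k(x) ⥲ k(x')`, e.g. the unique near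
point on `ℙ(Dir_x(X)) ≅ ℙ⁰_{k(x)}` when `e_x(X) = 1`): `e_x(X)_{k(x')} = e_x(X)_{k(x)} = e_x(X)` along the isomorphism.
[cite: CossartJannsenSaito2020, Thm. 3.10 (4), Def. 6.34 (i), p. 103] -/
theorem dirDim_le_of_hsFun_eq_of_isIso_residueFieldMap (h : CossartJannsenSaito2020_thm_3_10_4.{u})
    (hX : Scheme.IsExcellent X) (hD : IdealSheafData.IsPermissible D) (hπ : IsBlowup π D)
    {N : ℕ} (hN : topologicalKrullDim X ≤ (N : WithBot ℕ∞)) {x' : X'}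
    (hx : π.base x' ∈ (D.support : Set X))
    (hnear : Scheme.hsFun X' N x' = Scheme.hsFun X N (π.base x')) [IsIso (π.residueFieldMap x')] :
    Scheme.dirDim X' x' ≤ Scheme.dirDim X (π.base x') := by
  let k := ResidueField (X.presheaf.stalk (π.base x'))
  let k' := ResidueField (X'.presheaf.stalk x')
  let φ : k →+* k' := (π.residueFieldMap x').hom
  letI algkk' : Algebra k k' := φ.toAlgebra
  have hle := dirDim_le_dirDimOver_of_hsFun_eq h hX hD hπ hN hx hnear
  -- `k(x') ≅ k(x)` as `k(x)`-algebras, so `e_x(X)_{k(x')} = e_x(X)_{k(x)} = e_x(X)`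
  have hbij : Function.Bijective φ := ConcreteCategory.bijective_of_isIso (π.residueFieldMap x')
  let e : k ≃+* k' := RingEquiv.ofBijective φ hbij
  let ψ : k' ≃ₐ[k] k :=
    { e.symm with
      commutes' := fun a => by
        show e.symm (algebraMap k k' a) = a
        exact e.symm_apply_apply a }
  have heq : @Scheme.dirDimOver X _ (π.base x') k' _ algkk' = Scheme.dirDim X (π.base x') := by
    rw [← Scheme.dirDimOver_residueField]
    exact (dirDimOver_eq_of_algEquiv (X.presheaf.stalk (π.base x')) ψ).symm
  exact le_trans hle (le_of_eq heq)

end Literature.AlgebraicGeometry.Resolution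

end
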